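import Mathlib
import HarnessLib
import Summits.NavierStokesRegularity.NavierStokesRegularity.Theorems.PoloidalWindowDoorPoloidalWindowRigidityZShockSlopeFunctionLocal

/-!
# Crux K2 `PoloidalWindowRigidity` (stmt-NavierStokesRegularity-19708), line `z_shock` — L0(b) AS STATED IN THE CARD: PATCHING LOCAL
# SLOPE FUNCTIONS ALONG CONNECTED LEVEL SETS

`--supports stmt-NavierStokesRegularity-19708 --as helper` (leafhand-ns-poloidalwindowdoor-2 g0, 2026-08-31).  Class-free topology +
the companion `…ZShockSlopeFunctionLocal` (L0(b) local form).  **No stub and no summit is closed by this file; Navier–Stokes regularity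
is NOT proved here.**

Card `Lines/z_shock.md` §«First lemma of R3»: «L0(b): `D_b ≡ 0` + `∇ₕw ≠ 0` on a connected open `Ω` ⇒ `∃ g̃, ∂_z v_b = g̃(w)·∂_b w` on
`Ω` whenever the level sets `{w = c} ∩ Ω` are connected; L0(c) [the honest remainder]: patching `g̃` across level-set components».
`…ZShockSlopeFunctionLocal` gives the slope function near every point where `∂_b w ≠ 0`.  This file does the patching UNDER THE CARD'S
CONNECTEDNESS PROVISO, in full generality:

* `exists_comp_eq_on_of_local` — topological patching: if near every point of `Ω` the function `Λ` is SOME function of `w`, and every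
  level set `Ω ∩ {w = c}` is preconnected, then `Λ = g̃ ∘ w` on `Ω` for one `g̃` (a locally constant function on a preconnected subtype is
  constant);
* `exists_slope_function_on` — quotient form: local identities `N = g_x(w)·D` near each `x ∈ Ω`, `D ≠ 0` on `Ω`, preconnected level
  sets ⇒ `N = g̃(w)·D` on `Ω`;
* `exists_slope_function_on_of_analytic` — analytic slice `f : ℝ³ → ℝ³`, minors of `(∂_b f₂·∇(∂_z f_b) − ∂_z f_b·∇(∂_b f₂), ∇f₂)` vanish
  everywhere (L0(a)), `Ω ⊆ {∂_b f₂ ≠ 0}` with preconnected level sets of `f₂` ⇒ ONE slope function on `Ω`;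
* `slope_function_on_of_class_autonomy` — class entry (binders of `stub_zShockThickAut`): the LOCAL autonomy clause at `z₀` yields, on
  every such `Ω` in the slice `t₀ = z₀.1`, `∂_z v_b = g̃(v₂)·∂_b v₂` with a single `g̃ : ℝ → ℝ`.

So L0 = L0(a) (tree `…ZShockAutonomyGlobal`) + L0(b) (this file and its companion) is in the tree exactly as the card words it; what is left
of the «globalisation of the local autonomy clause» is L0(c) alone — the possible multi-valuedness of `g̃` across DIFFERENT components of a
level set `{v₂ = c}` of the slice (and across the zero set of `∂_b v₂`), which the card hands either to a slice-global re-typing of the stub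
or to the residue side.  presearch: «locally a function of ⇒ globally on connected level sets» — elementary; nothing in Mathlib/tree beyond
`IsLocallyConstant.apply_eq_of_preconnectedSpace`, which is the tool used. [folklore]
-/

noncomputable section

namespace Summit.NavierStokesRegularity.NavierStokesRegularity.Theorems.PoloidalWindowDoorPoloidalWindowRigidityZShockSlopeFunctionPatching

-- the problem directory repeats the summit name (`NavierStokesRegularity/NavierStokesRegularity`)
set_option linter.dupNamespace false

open Set Filter Topology Function
open Summit.NavierStokesRegularity.NavierStokesRegularity.Theorems.PoloidalWindowDoorPoloidalWindowRigidityZShockSlopeFunctionLocal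
open Summit.NavierStokesRegularity.NavierStokesRegularity.Theorems.PoloidalWindowDoorPoloidalWindowRigidityZShockAutonomyGlobal

/-! ## Topological patching -/

/-- **Patching local composites along connected level sets.**  Let `Λ, w : X → ℝ` and `Ω ⊆ X`.  If near every point of `Ω` (within
`Ω`) one has `Λ = g_x ∘ w` for SOME `g_x : ℝ → ℝ`, and every level set `Ω ∩ w⁻¹{c}` is preconnected, then there is ONE `g̃ : ℝ → ℝ` with
`Λ = g̃ ∘ w` on `Ω`.  Proof: on the subtype `Ω ∩ w⁻¹{c}` the function `Λ` is locally constant, hence constant. [folklore] -/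
theorem exists_comp_eq_on_of_local {X : Type*} [TopologicalSpace X] {Λ w : X → ℝ} {Ω : Set X}
    (hloc : ∀ x ∈ Ω, ∃ g : ℝ → ℝ, ∀ᶠ x' in 𝓝[Ω] x, Λ x' = g (w x'))
    (hconn : ∀ c : ℝ, IsPreconnected (Ω ∩ w ⁻¹' {c})) :
    ∃ g : ℝ → ℝ, ∀ x ∈ Ω, Λ x = g (w x) := by
  classical
  -- `Λ` is constant on each level set `Ω ∩ w⁻¹{c}`
  have hconst : ∀ c : ℝ, ∀ x ∈ Ω ∩ w ⁻¹' {c}, ∀ x' ∈ Ω ∩ w ⁻¹' {c}, Λ x = Λ x' := by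
    intro c x hx x' hx'
    haveI : PreconnectedSpace (Ω ∩ w ⁻¹' {c} : Set X) := Subtype.preconnectedSpace (hconn c)
    have hlc : IsLocallyConstant (fun p : (Ω ∩ w ⁻¹' {c} : Set X) => Λ p) := by
      rw [IsLocallyConstant.iff_eventually_eq]
      intro p
      obtain ⟨g, hg⟩ := hloc p p.2.1
      have htend : Tendsto (fun q : (Ω ∩ w ⁻¹' {c} : Set X) => (q : X)) (𝓝 p) (𝓝[Ω] (p : X)) :=
        tendsto_nhdsWithin_iff.2 ⟨continuousAt_subtype_val, Eventually.of_forall fun q => q.2.1⟩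
      have hg' : ∀ᶠ q in 𝓝 p, Λ ((fun q : (Ω ∩ w ⁻¹' {c} : Set X) => (q : X)) q) =
          g (w ((fun q : (Ω ∩ w ⁻¹' {c} : Set X) => (q : X)) q)) := htend.eventually hg
      have hgp : Λ (p : X) = g (w p) := hg.self_of_nhdsWithin p.2.1
      filter_upwards [hg'] with q hq
      have hwq : w q = c := q.2.2
      have hwp : w p = c := p.2.2
      rw [hq, hwq, hgp, hwp]
    exact hlc.apply_eq_of_preconnectedSpace ⟨x, hx⟩ ⟨x', hx'⟩
  refine ⟨fun c => if h : ∃ x ∈ Ω, w x = c then Λ h.choose else 0, fun x hx => ?_⟩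
  have h : ∃ x' ∈ Ω, w x' = w x := ⟨x, hx, rfl⟩
  dsimp only
  rw [dif_pos h]
  exact hconst (w x) x ⟨hx, rfl⟩ h.choose ⟨h.choose_spec.1, h.choose_spec.2⟩

/-- **Patching, quotient form.**  Local slope functions `N = g_x(w)·D` near each point of `Ω`, `D ≠ 0` on `Ω`, and preconnected level
sets `Ω ∩ w⁻¹{c}` give ONE slope function: `N = g̃(w)·D` on `Ω`. [folklore] -/
theorem exists_slope_function_on {X : Type*} [TopologicalSpace X] {N D w : X → ℝ} {Ω : Set X}
    (hD : ∀ x ∈ Ω, D x ≠ 0)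
    (hloc : ∀ x ∈ Ω, ∃ g : ℝ → ℝ, ∀ᶠ x' in 𝓝 x, N x' = g (w x') * D x')
    (hconn : ∀ c : ℝ, IsPreconnected (Ω ∩ w ⁻¹' {c})) :
    ∃ g : ℝ → ℝ, ∀ x ∈ Ω, N x = g (w x) * D x := by
  have hloc' : ∀ x ∈ Ω, ∃ g : ℝ → ℝ, ∀ᶠ x' in 𝓝[Ω] x, N x' / D x' = g (w x') := by
    intro x hx
    obtain ⟨g, hg⟩ := hloc x hx
    refine ⟨g, ?_⟩
    filter_upwards [nhdsWithin_le_nhds hg, self_mem_nhdsWithin] with x' hx' hx'Ω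
    rw [hx', mul_div_assoc, div_self (hD x' hx'Ω), mul_one]
  obtain ⟨g, hg⟩ := exists_comp_eq_on_of_local hloc' hconn
  refine ⟨g, fun x hx => ?_⟩
  rw [← hg x hx, div_mul_cancel₀ _ (hD x hx)]

/-! ## L0(b) on a region with connected level sets -/

/-- **L0(b) as stated in the card, for an analytic slice.**  Let `f : ℝ³ → ℝ³` be real-analytic, `b : Fin 3`, and suppose the minors of
`(∂_b f₂·∇(∂_z f_b) − ∂_z f_b·∇(∂_b f₂), ∇f₂)` vanish everywhere (the conclusion of L0(a)).  Let `Ω ⊆ ℝ³` be a set on which `∂_b f₂ ≠ 0`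
and whose level sets `Ω ∩ {f₂ = c}` are preconnected.  Then ONE slope function serves on `Ω`: `∂_z f_b = g̃(f₂)·∂_b f₂` on `Ω`. [folklore] -/
theorem exists_slope_function_on_of_analytic {f : EuclideanSpace ℝ (Fin 3) → EuclideanSpace ℝ (Fin 3)}
    (hf : AnalyticOnNhd ℝ f univ) {b : Fin 3}
    (hminor : ∀ x u u' : EuclideanSpace ℝ (Fin 3),
      (fderiv ℝ f x (EuclideanSpace.single b 1) 2 *
            fderiv ℝ (fun y => fderiv ℝ f y (EuclideanSpace.single 2 1) b) x u -
          fderiv ℝ f x (EuclideanSpace.single 2 1) b *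
            fderiv ℝ (fun y => fderiv ℝ f y (EuclideanSpace.single b 1) 2) x u) *
          fderiv ℝ (fun y => f y 2) x u' -
        (fderiv ℝ f x (EuclideanSpace.single b 1) 2 *
            fderiv ℝ (fun y => fderiv ℝ f y (EuclideanSpace.single 2 1) b) x u' -
          fderiv ℝ f x (EuclideanSpace.single 2 1) b *
            fderiv ℝ (fun y => fderiv ℝ f y (EuclideanSpace.single b 1) 2) x u') *
          fderiv ℝ (fun y => f y 2) x u = 0)
    {Ω : Set (EuclideanSpace ℝ (Fin 3))} (hΩ : ∀ x ∈ Ω, fderiv ℝ f x (EuclideanSpace.single b 1) 2 ≠ 0)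
    (hconn : ∀ c : ℝ, IsPreconnected (Ω ∩ (fun y => f y 2) ⁻¹' {c})) :
    ∃ g : ℝ → ℝ, ∀ x ∈ Ω, fderiv ℝ f x (EuclideanSpace.single 2 1) b =
      g (f x 2) * fderiv ℝ f x (EuclideanSpace.single b 1) 2 := by
  refine exists_slope_function_on (N := fun y => fderiv ℝ f y (EuclideanSpace.single 2 1) b)
    (D := fun y => fderiv ℝ f y (EuclideanSpace.single b 1) 2) (w := fun y => f y 2) hΩ (fun x hx => ?_) hconn
  obtain ⟨g, U, hU, hxU, hgU⟩ := exists_slope_function_near_of_analytic hf hminor (hΩ x hx)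
  exact ⟨g, Filter.mem_of_superset (hU.mem_nhds hxU) fun x' hx' => hgU x' hx'⟩

/-- **L0(a) + L0(b) for the route's class.**  Class binders of `stub_zShockThickAut` (Type-I rate, continuity on the slab, unit-viscosity
Oseen identity), the stub's LOCAL autonomy clause at `z₀ ∈ W₁`, `b ≠ 2`, and a set `Ω` in the slice `t₀ = z₀.1` on which `∂_b v₂ ≠ 0` and
whose level sets of `v₂` are preconnected ⇒ ONE slope function on `Ω`: `∂_z v_b = g̃(v₂)·∂_b v₂` there.  (L0(c) — different components
of a level set, and the zero set of `∂_b v₂` — is not addressed.) [folklore] -/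
theorem slope_function_on_of_class_autonomy (C : ℝ) (v : ℝ → EuclideanSpace ℝ (Fin 3) → EuclideanSpace ℝ (Fin 3))
    (hrate : Literature.Analysis.FluidPDE.HasTypeITimeDecay C v)
    (hcont : ContinuousOn (Function.uncurry v) (Set.Iio (0 : ℝ) ×ˢ Set.univ))
    (hmild : ∀ s t : ℝ, s < t → t < 0 → ∀ x, v t x =
      Literature.Analysis.UnboundedOperators.heatExtension (v s) (t - s) x -
        Literature.Analysis.FluidPDE.oseenDuhamel 1 s v v t x)
    {W₁ : Set (ℝ × EuclideanSpace ℝ (Fin 3))} (hW₁ : IsOpen W₁) (hW₁s : W₁ ⊆ Set.Iio (0 : ℝ) ×ˢ Set.univ)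
    {z₀ : ℝ × EuclideanSpace ℝ (Fin 3)} (hz₀ : z₀ ∈ W₁) {g : ℝ → ℝ → ℝ}
    (haut : ∀ z ∈ W₁, ∀ b : Fin 3, b ≠ 2 →
      fderiv ℝ (v z.1) z.2 (EuclideanSpace.single 2 1) b =
        g z.1 (v z.1 z.2 2) * fderiv ℝ (v z.1) z.2 (EuclideanSpace.single b 1) 2)
    {b : Fin 3} (hb : b ≠ 2) {Ω : Set (EuclideanSpace ℝ (Fin 3))}
    (hΩ : ∀ x ∈ Ω, fderiv ℝ (v z₀.1) x (EuclideanSpace.single b 1) 2 ≠ 0)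
    (hconn : ∀ c : ℝ, IsPreconnected (Ω ∩ (fun y => v z₀.1 y 2) ⁻¹' {c})) :
    ∃ gΩ : ℝ → ℝ, ∀ x ∈ Ω, fderiv ℝ (v z₀.1) x (EuclideanSpace.single 2 1) b =
      gΩ (v z₀.1 x 2) * fderiv ℝ (v z₀.1) x (EuclideanSpace.single b 1) 2 := by
  -- slice analyticity (as in `minors_eq_zero_of_class_autonomy`)
  have ht₀ : z₀.1 < 0 := (Set.mem_prod.1 (hW₁s hz₀)).1
  have hbdd : ∀ δ : ℝ, 0 < δ → ∃ B : ℝ, ∀ t < -δ, ∀ y : EuclideanSpace ℝ (Fin 3), ‖v t y‖ ≤ B := by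
    intro δ hδ
    refine ⟨|C| / Real.sqrt δ, fun t ht y => ?_⟩
    have hδt : δ ≤ -t := by linarith
    have hsq : Real.sqrt δ ≤ Real.sqrt (-t) := Real.sqrt_le_sqrt hδt
    have hsqpos : 0 < Real.sqrt δ := Real.sqrt_pos.2 hδ
    calc ‖v t y‖ ≤ C / Real.sqrt (-t) := hrate t (by linarith) y
      _ ≤ |C| / Real.sqrt (-t) := by gcongr; exact le_abs_self C
      _ ≤ |C| / Real.sqrt δ := by gcongr
  have han : AnalyticOnNhd ℝ (v z₀.1) univ :=
    Literature.Analysis.NavierStokesZoomKit.LocalSineTubeDoorProfileAlignedWindowRigidityAncient.analyticOnNhd_slice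
      hcont hbdd hmild ht₀
  exact exists_slope_function_on_of_analytic han
    (fun y u u' => minors_eq_zero_of_class_autonomy C v hrate hcont hmild hW₁ hW₁s hz₀ haut hb y u u') hΩ hconn

end Summit.NavierStokesRegularity.NavierStokesRegularity.Theorems.PoloidalWindowDoorPoloidalWindowRigidityZShockSlopeFunctionPatching

end
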